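import Literature.Computability.AlgebraicComplexity.LMR13PLambdaStabilizerThree
import Literature.Computability.AlgebraicComplexity.LMR13BoundaryMaximality
import HarnessLib

/-!
# LMR 2013 Prop. 3.5.1 at `n = 3`: `Δ(P_{Λ,3})` is a codimension-one component of `∂Δ(det₃)` — PROVED

Landsberg–Manivel–Ressayre 2013, Prop. 3.5.1 (journal p. 481; arXiv:1004.4802 `p0008.txt:L60–63`):
"The polynomial `P_Λ` belongs to the orbit closure of the determinant. Moreover, `\overline{GL(W)·P_Λ}`
is an irreducible codimension one component of the boundary of `\overline{GL(W)·[det_n]}`, not contained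
in `End(W)·[det_n]`. In particular `\overline{dc}(P_{Λ,m}) = m < dc(P_{Λ,m})`." The tree's named fact
`LMR2013_prop_3_5_1` (`LMR13DualVarieties.lean`) types the six clauses for every odd `n ≥ 3`; by
`LMR2013_prop_3_5_1_of_finrank_glAnn_le` (`LMR13BoundaryMaximality.lean`) it follows from the single
stabiliser inequality `dim 𝔤𝔩(W)_{P_Λ} ≤ dim 𝔤𝔩(W)_{det_n} + 1`, open for general `n`.

This file PROVES the `n = 3` instance of all six clauses (`LMR2013_prop_3_5_1_three`), unconditionally,
from the stabiliser count `finrank_glAnn_pLambda_three_le` (`LMR13PLambdaStabilizerThree.lean`), the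
lower bound `finrank_glAnn_detPoly_ge` (`LMR13StabilizerDimensions.lean`), the per-`n` component glue
`isCoeffIrreducibleComponent_orbitClosure_pLambda_of_codim` /
`affineDimension_orbitClosure_pLambda_add_one_eq_of_finrank_glAnn_le` and the landed clauses (a), (d),
(e), (f) (`pLambda_mem_orbitClosure_detPoly`, `not_orbitClosure_pLambda_subset_endOrbit`,
`borderDc_pLambda`, `lt_determinantalComplexity_pLambda`). For `n = 3` the statement is also the
`P₂`-component of Hüttenhain–Lairez's description of `∂Ω(det₃)` (arXiv:1512.02437, Thm. 1).

Theorem-only (no definitions, no named facts). Honest framing: one explicit boundary component of the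
`3 × 3` determinant's orbit closure; **VP ≠ VNP is NOT proved and nothing here is progress on it.**

## References

* [LandsbergManivelRessayre2013] J. M. Landsberg, L. Manivel, N. Ressayre, *Hypersurfaces with
  degenerate duals and the geometric complexity theory program*, Comment. Math. Helv. 88 (2013)
  469–484, Prop. 3.5.1 (p. 481); arXiv:1004.4802.
* [HuttenhainLairez2016] J. Hüttenhain, P. Lairez, *The boundary of the orbit of the 3-by-3 determinant
  polynomial*, C. R. Math. Acad. Sci. Paris 354 (2016) 931–935 = arXiv:1512.02437, Thm. 1.
-/

noncomputable section

open MvPolynomial Matrix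

namespace Literature.Computability.AlgebraicComplexity

/-- **The stabiliser inequality of Prop. 3.5.1 at `n = 3`**: `dim 𝔤𝔩(W)_{P_{Λ,3}} ≤ dim 𝔤𝔩(W)_{det₃} + 1`
(`17 ≤ 16 + 1`). [cite: LandsbergManivelRessayre2013, Proposition 3.5.1 (p. 481)] -/
theorem finrank_glAnn_pLambda_three_le_finrank_glAnn_detPoly_add_one :
    Module.finrank ℂ (glAnn (pLambda 3)) ≤ Module.finrank ℂ (glAnn (detPoly (Fin 3) ℂ)) + 1 := by
  have h1 := finrank_glAnn_pLambda_three_le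
  have h2 := finrank_glAnn_detPoly_ge 3
  omega

/-- **Codimension one at `n = 3`**: `dim Δ(P_{Λ,3}) + 1 = dim Δ(det₃)` (cones in degree-`3` coefficient
space). [cite: LandsbergManivelRessayre2013, Proposition 3.5.1 (p. 481)] -/
theorem affineDimension_orbitClosure_pLambda_three_add_one :
    affineDimension (formCoeff 3 '' orbitClosure (pLambda 3)) + 1 =
      affineDimension (formCoeff 3 '' orbitClosure (detPoly (Fin 3) ℂ)) :=
  affineDimension_orbitClosure_pLambda_add_one_eq_of_finrank_glAnn_le (by decide) le_rfl
    finrank_glAnn_pLambda_three_le_finrank_glAnn_detPoly_add_one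

/-- **`Δ(P_{Λ,3})` is an irreducible component of the boundary `Δ(det₃) ∖ GL(W)·det₃`.**
[cite: LandsbergManivelRessayre2013, Proposition 3.5.1 (p. 481)] -/
theorem isCoeffIrreducibleComponent_orbitClosure_pLambda_three :
    IsCoeffIrreducibleComponent (orbitClosure (pLambda 3))
      (orbitClosure (detPoly (Fin 3) ℂ) \ glOrbit (Fin 3 × Fin 3) ℂ (detPoly (Fin 3) ℂ)) :=
  isCoeffIrreducibleComponent_orbitClosure_pLambda_of_codim (by decide) le_rfl
    affineDimension_orbitClosure_pLambda_three_add_one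

/-- **LMR 2013, Prop. 3.5.1 at `n = 3` (all six typed clauses), PROVED**: (a) `P_{Λ,3} ∈ Δ(det₃)`;
(b) `Δ(P_{Λ,3})` is an irreducible component of the boundary `Δ(det₃) ∖ GL(W)·det₃`; (c) it has
codimension one in `Δ(det₃)`; (d) it is not contained in `End(W)·det₃`; (e) `\overline{dc}(P_{Λ,3}) = 3`;
(f) `3 < dc(P_{Λ,3})`. This is the body of the named fact `LMR2013_prop_3_5_1` at `n = 3`.
[cite: LandsbergManivelRessayre2013, Proposition 3.5.1 (p. 481)] -/
theorem LMR2013_prop_3_5_1_three :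
    pLambda 3 ∈ orbitClosure (detPoly (Fin 3) ℂ) ∧
    IsCoeffIrreducibleComponent (orbitClosure (pLambda 3))
      (orbitClosure (detPoly (Fin 3) ℂ) \ glOrbit (Fin 3 × Fin 3) ℂ (detPoly (Fin 3) ℂ)) ∧
    affineDimension (formCoeff 3 '' orbitClosure (pLambda 3)) + 1 =
      affineDimension (formCoeff 3 '' orbitClosure (detPoly (Fin 3) ℂ)) ∧
    ¬ (orbitClosure (pLambda 3) ⊆ endOrbit (Fin 3 × Fin 3) ℂ (detPoly (Fin 3) ℂ)) ∧
    borderDc (pLambda 3) 3 = 3 ∧ 3 < determinantalComplexity (pLambda 3) :=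
  ⟨pLambda_mem_orbitClosure_detPoly (by decide),
    isCoeffIrreducibleComponent_orbitClosure_pLambda_three,
    affineDimension_orbitClosure_pLambda_three_add_one,
    not_orbitClosure_pLambda_subset_endOrbit (by decide) le_rfl,
    borderDc_pLambda (by decide),
    lt_determinantalComplexity_pLambda (by decide) le_rfl⟩

end Literature.Computability.AlgebraicComplexity
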